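import Summits.HubbardSuperconductivity.HubbardSuperconductivity.Theorems.KLProgrammeKLRegimeFlowReadScaleZeroSunsetFarGapCertDefs
import Summits.HubbardSuperconductivity.HubbardSuperconductivity.Theorems.KLProgrammeKLRegimeFlowReadScaleZeroSunsetFarSupCertDefs

/-!
# Route `KLProgramme`, crux K3 — engine-flow child (stmt-HubbardSuperconductivity-20437), stub (C) at `n = 0`, located item #22a «(C)-SCALE0-PT2»:
# ONE μ-FREE FAR RECORD SERVES EVERY CELL — restriction of the far-gap and far-sup certificates to sub-cells with the same split radius

Seat hubbard-kl-k3c5-p1 (g18; owner of #22a).  The two far certificates `ScaleZeroFarGapCert c r` (KIT JOB B′, after this seat's `…ScaleZeroMidShellFarGap`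
only the inner shell `(0, 1/32)`) and `ScaleZeroFarSupCert c rs` (B″, booked `Sfar = 353521920428/10¹⁶`) are stated per near record `c` — they quantify over
`μ ∈ [c.μlo, c.μhi]` and read the near box `{0} ∪ c.disk`, which depends on `c.Rc` only.  The kit produces ONE record for the whole window `klWindowC` at
`Rc = 1024` (the far side is μ-free by design, CONSUMER-MAP §kit); the per-cell hypotheses of the one-calls (`sunsetRows_of_records_farSup`,
`sunsetRows_of_records3_farSup`, `sunsetRows_of_records_innerGap_farSup`) then follow by RESTRICTION:
* `SunsetCellRecordV2.disk_eq_of_Rc_eq` — cells with the same `Rc` have the same near box;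
* `ScaleZeroFarGapCert.mono_cell`, `ScaleZeroFarSupCert.mono_cell` — a certificate for a cell `c` restricts to any cell `c'` with `c'.Rc = c.Rc` and
  `[c'.μlo, c'.μhi] ⊆ [c.μlo, c.μhi]` (rational side conditions, `norm_num` on literals).
Proofs only; the certificates stay HYPOTHESES; nothing here asserts (C), any stub of 20437, K3, the margin or superconductivity.
References: BGM 2006 §2.3 [cite: BenfattoGiulianiMastropietro2006].
-/

noncomputable section

namespace Summit.HubbardSuperconductivity.HubbardSuperconductivity.Theorems.KLRegimeSplit

set_option linter.dupNamespace false -- summit = problem name (single-conjunct summit), D-0017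

open Literature.MathematicalPhysics.QuantumLattice Literature.Probability.LatticeModels Literature.Analysis.FunctionSpaces
open Summit.HubbardSuperconductivity.HubbardSuperconductivity.Theorems.DispersionFlow
open MeasureTheory Finset Complex UnitAddTorus Real

/-- Cells with the same split radius have the same near box `disk = {z : 0 < ‖z‖∞ ≤ Rc}`. [cite: BenfattoGiulianiMastropietro2006, §2.3] -/
theorem SunsetCellRecordV2.disk_eq_of_Rc_eq {c c' : SunsetCellRecordV2} (h : c'.Rc = c.Rc) : c'.disk = c.disk := by
  simp only [SunsetCellRecordV2.disk, h]

/-- **Restriction of the far-gap certificate to a sub-cell with the same split radius**: if `c'.Rc = c.Rc`, `c.μlo ≤ c'.μlo` and `c'.μhi ≤ c.μhi`,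
then `ScaleZeroFarGapCert c r → ScaleZeroFarGapCert c' r` (ONE μ-free record serves every cell of the window). [cite: BenfattoGiulianiMastropietro2006, §2.3] -/
theorem ScaleZeroFarGapCert.mono_cell {c c' : SunsetCellRecordV2} {r : SunsetFarGapRecord} (h : ScaleZeroFarGapCert c r)
    (hRc : c'.Rc = c.Rc) (hlo : c.μlo ≤ c'.μlo) (hhi : c'.μhi ≤ c.μhi) : ScaleZeroFarGapCert c' r := by
  intro μ hμlo hμhi om hom hlt
  have hμlo' : (c.μlo : ℝ) ≤ μ := le_trans (by exact_mod_cast hlo) hμlo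
  have hμhi' : μ ≤ (c.μhi : ℝ) := le_trans hμhi (by exact_mod_cast hhi)
  rw [SunsetCellRecordV2.disk_eq_of_Rc_eq hRc]
  exact h μ hμlo' hμhi' om hom hlt

/-- **Restriction of the far-sup certificate to a sub-cell with the same split radius**: if `c'.Rc = c.Rc`, `c.μlo ≤ c'.μlo` and `c'.μhi ≤ c.μhi`,
then `ScaleZeroFarSupCert c rs → ScaleZeroFarSupCert c' rs`. [cite: BenfattoGiulianiMastropietro2006, §2.3] -/
theorem ScaleZeroFarSupCert.mono_cell {c c' : SunsetCellRecordV2} {rs : SunsetFarSupRecord} (h : ScaleZeroFarSupCert c rs)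
    (hRc : c'.Rc = c.Rc) (hlo : c.μlo ≤ c'.μlo) (hhi : c'.μhi ≤ c.μhi) : ScaleZeroFarSupCert c' rs := by
  obtain ⟨P, hP, hdom, hper⟩ := h
  refine ⟨P, hP, ?_, hper⟩
  intro μ hμlo hμhi z hz t u htu
  have hμlo' : (c.μlo : ℝ) ≤ μ := le_trans (by exact_mod_cast hlo) hμlo
  have hμhi' : μ ≤ (c.μhi : ℝ) := le_trans hμhi (by exact_mod_cast hhi)
  rw [SunsetCellRecordV2.disk_eq_of_Rc_eq hRc] at hz
  exact hdom μ hμlo' hμhi' z hz t u htu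

end Summit.HubbardSuperconductivity.HubbardSuperconductivity.Theorems.KLRegimeSplit

end
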